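import Literature.RepresentationTheory.Kovacevic2021.SU21PrincipalSeriesCompositionFactors
import Literature.RepresentationTheory.Kovacevic2021.SU21HolomorphicCompositionFactors
import HarnessLib

/-!
# The composition series of `V(0,0)`, `V(−3/2, 6)`, `V(−3/2, −6)` are strictly increasing

Complement to `…Kovacevic2021.SU21PrincipalSeriesCompositionFactors` and `…SU21HolomorphicCompositionFactors` (the
successive subquotients of the chains below are irreducible and isomorphic to the six cohomological modules).  Here the
chains themselves are shown to be STRICTLY increasing chains of Lie submodules, so that they are composition series in the
usual sense [BorelWallach2000, VI 4.10 (10)] [Kovacevic2021, §4]: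
* `V(0,0)`: `⊥ < N_v < N_row < N_row ⊔ N_col < ⊤` (`bot_lt_span00Vertex`, `span00Vertex_lt_span00Row`,
  `span00Row_lt_sup`, `span00_sup_lt_top`; also `span00Vertex_lt_span00Col`), factors `J_{0,0}, J_{1,0}, J_{0,1}, D_1`;
* `V(−3/2,6)`: `⊥ < N_ray < N_strip < ⊤` (`bot_lt_spanHolRay`, `spanHolRay_lt_spanHolStrip`, `spanHolStrip_lt_top`),
  factors `D_2, J_{1,0}, D_1`;
* `V(−3/2,−6)`: `⊥ < N_ray' < N_strip' < ⊤` (`bot_lt_spanAntiholRay`, `spanAntiholRay_lt_spanAntiholStrip`,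
  `spanAntiholStrip_lt_top`), factors `D_0, J_{0,1}, D_1`.
Each strict inclusion is witnessed by a highest-weight vector `u^1_{n,m}` (the `K`-type sets computed in
`SU21PrincipalSeriesCohomologicalPoints`).  Theorems only; no definitions, no named facts.

## References

* A. Borel, N. Wallach (2000), VI 4.10 (10) p. 132. [BorelWallach2000]
* D. Kovačević, *Unitary `(𝔤,K)` modules of `SU(2,1)`*, Acta Math. Spalatensia 1 (2021) 105–125, §3 Thm 3,
  §4. [Kovacevic2021]
-/

noncomputable section

namespace Literature.RepresentationTheory.Kovacevic2021

-- Mathlib idiom (Mathlib/Algebra/Lie/OfAssociative.lean): commutator brackets on associative algebras; needed for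
-- the `𝔤𝔩(3,ℂ)`-module structure on `𝒟.V`, as in every file of this directory.
attribute [local instance 100] LieRing.ofAssociativeRing

namespace SU21Datum

open PrincipalSeries

/-! ## §1 `V(0,0)` -/

/-- membership of `u^1_{(p,q)}` in `N_v` [cite: Kovacevic2021, §4 (`U(0)`)] -/
private theorem mem_vertex00 {p q : ℤ} (hp : 0 ≤ p) (hq : 0 ≤ q) :
    (principalSeries 0 0).vec (1 + p + q) (2 * 0 + 3 * p - 3 * q) 1 ∈ span00Vertex ↔ p = 0 ∧ q = 0 := by
  rw [span00Vertex, principalSeries_zero_zero_vec_mem_lieSpan_vertex_iff hp hq]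

/-- membership of `u^1_{(p,q)}` in `N_row` [cite: Kovacevic2021, §4 (`Z(3)`)] -/
private theorem mem_row00 {p q : ℤ} (hp : 0 ≤ p) (hq : 0 ≤ q) :
    (principalSeries 0 0).vec (1 + p + q) (2 * 0 + 3 * p - 3 * q) 1 ∈ span00Row ↔ q = 0 := by
  rw [span00Row, principalSeries_zero_zero_vec_mem_lieSpan_iff_of_q_zero le_rfl hp hq]

/-- membership of `u^1_{(p,q)}` in `N_col` [cite: Kovacevic2021, §4 (`Z(−3)`)] -/
private theorem mem_col00 {p q : ℤ} (hp : 0 ≤ p) (hq : 0 ≤ q) :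
    (principalSeries 0 0).vec (1 + p + q) (2 * 0 + 3 * p - 3 * q) 1 ∈ span00Col ↔ p = 0 := by
  rw [span00Col, principalSeries_zero_zero_vec_mem_lieSpan_iff_of_p_zero le_rfl hp hq]

/-- the highest-weight vectors of `V(0,0)` are non-zero [cite: Kovacevic2021, §3 Def 1] -/
private theorem vec00_ne_zero {p q : ℤ} (hp : 0 ≤ p) (hq : 0 ≤ q) :
    (principalSeries 0 0).vec (1 + p + q) (2 * 0 + 3 * p - 3 * q) 1 ≠ 0 :=
  vec_ne_zero ⟨mem_cone hp hq rfl rfl, le_rfl, by omega⟩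

/-- `0 < N_v` [cite: BorelWallach2000, VI 4.10 (10)] -/
theorem bot_lt_span00Vertex : (⊥ : LieSubmodule ℂ (Matrix (Fin 3) (Fin 3) ℂ) (principalSeries 0 0).V) < span00Vertex :=
  SetLike.lt_iff_le_and_exists.2 ⟨bot_le, _, (mem_vertex00 le_rfl le_rfl).2 ⟨rfl, rfl⟩,
    fun h => vec00_ne_zero le_rfl le_rfl ((LieSubmodule.mem_bot _).1 h)⟩

/-- `N_v < N_row` (witness `u^1_{2,3}`) [cite: BorelWallach2000, VI 4.10 (10)] [cite: Kovacevic2021, §4] -/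
theorem span00Vertex_lt_span00Row : span00Vertex < span00Row := by
  refine SetLike.lt_iff_le_and_exists.2 ⟨?_, (principalSeries 0 0).vec (1 + 1 + 0) (2 * 0 + 3 * 1 - 3 * 0) 1,
    (mem_row00 zero_le_one le_rfl).2 rfl, fun h => by have := (mem_vertex00 zero_le_one le_rfl).1 h; omega⟩
  rw [span00Vertex, LieSubmodule.lieSpan_le, Set.singleton_subset_iff]
  exact (mem_row00 le_rfl le_rfl).2 rfl

/-- `N_v < N_col` (witness `u^1_{2,−3}`) [cite: BorelWallach2000, VI 4.10 (10)] [cite: Kovacevic2021, §4] -/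
theorem span00Vertex_lt_span00Col : span00Vertex < span00Col := by
  refine SetLike.lt_iff_le_and_exists.2 ⟨?_, (principalSeries 0 0).vec (1 + 0 + 1) (2 * 0 + 3 * 0 - 3 * 1) 1,
    (mem_col00 le_rfl zero_le_one).2 rfl, fun h => by have := (mem_vertex00 le_rfl zero_le_one).1 h; omega⟩
  rw [span00Vertex, LieSubmodule.lieSpan_le, Set.singleton_subset_iff]
  exact (mem_col00 le_rfl le_rfl).2 rfl

/-- `N_row < N_row ⊔ N_col` (witness `u^1_{2,−3}`) [cite: BorelWallach2000, VI 4.10 (10)] [cite: Kovacevic2021, §4] -/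
theorem span00Row_lt_sup : span00Row < span00Row ⊔ span00Col :=
  SetLike.lt_iff_le_and_exists.2 ⟨le_sup_left, (principalSeries 0 0).vec (1 + 0 + 1) (2 * 0 + 3 * 0 - 3 * 1) 1,
    LieSubmodule.mem_sup_right ((mem_col00 le_rfl zero_le_one).2 rfl),
    fun h => by have := (mem_row00 le_rfl zero_le_one).1 h; omega⟩

/-- `N_row ⊔ N_col < V(0,0)` (witness `u^1_{3,0}`, an interior `K`-type) [cite: BorelWallach2000, VI 4.10 (10)]
[cite: Kovacevic2021, §4 (`W(3,0)`)] -/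
theorem span00_sup_lt_top : span00Row ⊔ span00Col < (⊤ : LieSubmodule ℂ (Matrix (Fin 3) (Fin 3) ℂ) (principalSeries 0 0).V) := by
  refine SetLike.lt_iff_le_and_exists.2 ⟨le_top, (principalSeries 0 0).vec (1 + 1 + 1) (2 * 0 + 3 * 1 - 3 * 1) 1,
    LieSubmodule.mem_top _, fun h => ?_⟩
  rcases (vec_one_mem_sup_iff _ _ (mem_cone zero_le_one zero_le_one rfl rfl)).1 h with h | h
  · have := (mem_row00 zero_le_one zero_le_one).1 h; omega
  · have := (mem_col00 zero_le_one zero_le_one).1 h; omega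

/-! ## §2 `V(−3/2, 6)` -/

/-- membership of `u^1_{(p,q)}` in `N_ray` [cite: Kovacevic2021, §4 (`U(0,6)`)] -/
private theorem mem_rayHol {p q : ℤ} (hp : 0 ≤ p) (hq : 0 ≤ q) :
    (principalSeries (-3 / 2) 3).vec (1 + p + q) (2 * 3 + 3 * p - 3 * q) 1 ∈ spanHolRay ↔ q = 0 := by
  rw [spanHolRay, principalSeries_hol_vec_mem_lieSpan_iff (p₀ := 0) (q₀ := 0) le_rfl le_rfl hp hq]; omega

/-- membership of `u^1_{(p,q)}` in `N_strip` [cite: Kovacevic2021, §4 (`Z(3)`)] -/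
private theorem mem_stripHol {p q : ℤ} (hp : 0 ≤ p) (hq : 0 ≤ q) :
    (principalSeries (-3 / 2) 3).vec (1 + p + q) (2 * 3 + 3 * p - 3 * q) 1 ∈ spanHolStrip ↔ q ≤ 1 := by
  rw [spanHolStrip, principalSeries_hol_vec_mem_lieSpan_iff (p₀ := 0) (q₀ := 1) le_rfl zero_le_one hp hq]; omega

/-- `0 < N_ray` [cite: BorelWallach2000, VI 4.10 (10)] -/
theorem bot_lt_spanHolRay : (⊥ : LieSubmodule ℂ (Matrix (Fin 3) (Fin 3) ℂ) (principalSeries (-3 / 2) 3).V) < spanHolRay :=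
  SetLike.lt_iff_le_and_exists.2 ⟨bot_le, (principalSeries (-3 / 2) 3).vec (1 + 0 + 0) (2 * 3 + 3 * 0 - 3 * 0) 1,
    (mem_rayHol le_rfl le_rfl).2 rfl,
    fun h => vec_ne_zero ⟨mem_cone le_rfl le_rfl rfl rfl, le_rfl, by norm_num⟩ ((LieSubmodule.mem_bot _).1 h)⟩

/-- `N_ray < N_strip` (witness `u^1_{2,3}`) [cite: BorelWallach2000, VI 4.10 (10)] [cite: Kovacevic2021, §4] -/
theorem spanHolRay_lt_spanHolStrip : spanHolRay < spanHolStrip := by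
  refine SetLike.lt_iff_le_and_exists.2 ⟨?_, (principalSeries (-3 / 2) 3).vec (1 + 0 + 1) (2 * 3 + 3 * 0 - 3 * 1) 1,
    (mem_stripHol le_rfl zero_le_one).2 le_rfl, fun h => by have := (mem_rayHol le_rfl zero_le_one).1 h; omega⟩
  rw [spanHolRay, LieSubmodule.lieSpan_le, Set.singleton_subset_iff]
  exact (mem_stripHol le_rfl le_rfl).2 zero_le_one

/-- `N_strip < V(−3/2,6)` (witness `u^1_{3,0}`, `q = 2`) [cite: BorelWallach2000, VI 4.10 (10)] [cite: Kovacevic2021, §4] -/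
theorem spanHolStrip_lt_top :
    spanHolStrip < (⊤ : LieSubmodule ℂ (Matrix (Fin 3) (Fin 3) ℂ) (principalSeries (-3 / 2) 3).V) :=
  SetLike.lt_iff_le_and_exists.2 ⟨le_top, (principalSeries (-3 / 2) 3).vec (1 + 0 + 2) (2 * 3 + 3 * 0 - 3 * 2) 1,
    LieSubmodule.mem_top _, fun h => by have := (mem_stripHol le_rfl (by norm_num : (0 : ℤ) ≤ 2)).1 h; omega⟩

/-! ## §3 `V(−3/2, −6)` -/

/-- membership of `u^1_{(p,q)}` in `N_ray'` [cite: Kovacevic2021, §4 (`U(0,−6)`)] -/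
private theorem mem_rayAntihol {p q : ℤ} (hp : 0 ≤ p) (hq : 0 ≤ q) :
    (principalSeries (-3 / 2) (-3)).vec (1 + p + q) (2 * (-3) + 3 * p - 3 * q) 1 ∈ spanAntiholRay ↔ p = 0 := by
  rw [spanAntiholRay, principalSeries_antihol_vec_mem_lieSpan_iff (p₀ := 0) (q₀ := 0) le_rfl le_rfl hp hq]; omega

/-- membership of `u^1_{(p,q)}` in `N_strip'` [cite: Kovacevic2021, §4 (`Z(−3)`)] -/
private theorem mem_stripAntihol {p q : ℤ} (hp : 0 ≤ p) (hq : 0 ≤ q) :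
    (principalSeries (-3 / 2) (-3)).vec (1 + p + q) (2 * (-3) + 3 * p - 3 * q) 1 ∈ spanAntiholStrip ↔ p ≤ 1 := by
  rw [spanAntiholStrip, principalSeries_antihol_vec_mem_lieSpan_iff (p₀ := 1) (q₀ := 0) zero_le_one le_rfl hp hq]
  omega

/-- `0 < N_ray'` [cite: BorelWallach2000, VI 4.10 (10)] -/
theorem bot_lt_spanAntiholRay :
    (⊥ : LieSubmodule ℂ (Matrix (Fin 3) (Fin 3) ℂ) (principalSeries (-3 / 2) (-3)).V) < spanAntiholRay :=
  SetLike.lt_iff_le_and_exists.2 ⟨bot_le, (principalSeries (-3 / 2) (-3)).vec (1 + 0 + 0) (2 * (-3) + 3 * 0 - 3 * 0) 1,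
    (mem_rayAntihol le_rfl le_rfl).2 rfl,
    fun h => vec_ne_zero ⟨mem_cone le_rfl le_rfl rfl rfl, le_rfl, by norm_num⟩ ((LieSubmodule.mem_bot _).1 h)⟩

/-- `N_ray' < N_strip'` (witness `u^1_{2,−3}`) [cite: BorelWallach2000, VI 4.10 (10)] [cite: Kovacevic2021, §4] -/
theorem spanAntiholRay_lt_spanAntiholStrip : spanAntiholRay < spanAntiholStrip := by
  refine SetLike.lt_iff_le_and_exists.2 ⟨?_, (principalSeries (-3 / 2) (-3)).vec (1 + 1 + 0) (2 * (-3) + 3 * 1 - 3 * 0) 1,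
    (mem_stripAntihol zero_le_one le_rfl).2 le_rfl, fun h => by have := (mem_rayAntihol zero_le_one le_rfl).1 h; omega⟩
  rw [spanAntiholRay, LieSubmodule.lieSpan_le, Set.singleton_subset_iff]
  exact (mem_stripAntihol le_rfl le_rfl).2 zero_le_one

/-- `N_strip' < V(−3/2,−6)` (witness `u^1_{3,0}`, `p = 2`) [cite: BorelWallach2000, VI 4.10 (10)] [cite: Kovacevic2021, §4] -/
theorem spanAntiholStrip_lt_top :
    spanAntiholStrip < (⊤ : LieSubmodule ℂ (Matrix (Fin 3) (Fin 3) ℂ) (principalSeries (-3 / 2) (-3)).V) :=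
  SetLike.lt_iff_le_and_exists.2 ⟨le_top, (principalSeries (-3 / 2) (-3)).vec (1 + 2 + 0) (2 * (-3) + 3 * 2 - 3 * 0) 1,
    LieSubmodule.mem_top _, fun h => by have := (mem_stripAntihol (by norm_num : (0 : ℤ) ≤ 2) le_rfl).1 h; omega⟩

end SU21Datum

end Literature.RepresentationTheory.Kovacevic2021
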